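import Mathlib
import HarnessLib

/-!
# `NoHeavyLowerTail` (crux stmt-CriticalPhenomena-4575), antithetic vdBHK programme: a SHADOW LEMMA (Daykin + Kleitman)

Support file (seat `prim-ineq-gen-7` gen 27; `--supports stmt-CriticalPhenomena-4575`).  No `sorry`, no definitions, nothing asserted about
the crux.  Memo: run/shared/lean/prim/prim-ineq-gen-7/FINDING-PHI-g27.md §7 (the 'activated units' of the distributed charging for the
abstract per-level inequality LEVEL(r)).

For a family `D` of subsets of a finite type, write `↓D = D ⊼ univ` (all subsets of members), `↑D = D ⊻ univ` (all supersets of members) and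
`σ` for the complement map.  Then `↓D ∩ σ(↑D) = {ξ : ξ ⊆ η \ η′ for some η, η′ ∈ D}` and

* `AntitheticShadow.card_le_card_infs_inter_compls_sups` — `#D ≤ #(↓D ∩ σ(↑D))` for EVERY family `D`.

Proof: Daykin's inequality (`Finset.le_card_infs_mul_card_sups`, the four functions theorem) with the second family `univ` gives
`#D · 2^n ≤ #↓D · #↑D`; `↓D` and `σ(↑D)` are lower families with `#σ(↑D) = #↑D`, so the Harris–Kleitman inequality
(`IsLowerSet.le_card_inter_finset`) gives `#↓D · #↑D ≤ 2^n · #(↓D ∩ σ(↑D))`.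
-/

namespace Summit.CriticalPhenomena.PercolationContinuityZ3.Theorems

open Finset
open scoped FinsetFamily

namespace AntitheticShadow

variable {β : Type*} [DecidableEq β] [Fintype β]

/-- Membership in the down-closure `D ⊼ univ`: `x ∈ D ⊼ univ ↔ ∃ a ∈ D, x ⊆ a`. [this work] -/
theorem mem_infs_univ (D : Finset (Finset β)) (x : Finset β) : x ∈ D ⊼ univ ↔ ∃ a ∈ D, x ⊆ a := by
  rw [Finset.mem_infs]
  constructor
  · rintro ⟨a, ha, b, -, rfl⟩
    exact ⟨a, ha, Finset.inter_subset_left⟩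
  · rintro ⟨a, ha, hx⟩
    exact ⟨a, ha, x, Finset.mem_univ _, Finset.inter_eq_right.mpr hx⟩

/-- Membership in the up-closure `D ⊻ univ`: `x ∈ D ⊻ univ ↔ ∃ a ∈ D, a ⊆ x`. [this work] -/
theorem mem_sups_univ (D : Finset (Finset β)) (x : Finset β) : x ∈ D ⊻ univ ↔ ∃ a ∈ D, a ⊆ x := by
  rw [Finset.mem_sups]
  constructor
  · rintro ⟨a, ha, b, -, rfl⟩
    exact ⟨a, ha, Finset.subset_union_left⟩
  · rintro ⟨a, ha, hx⟩
    exact ⟨a, ha, x, Finset.mem_univ _, Finset.union_eq_right.mpr hx⟩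

/-- The down-closure `D ⊼ univ` is a lower family. [this work] -/
theorem isLowerSet_infs_univ (D : Finset (Finset β)) : IsLowerSet ((D ⊼ univ : Finset (Finset β)) : Set (Finset β)) := by
  intro x y hyx hx
  rw [Finset.mem_coe, mem_infs_univ] at hx ⊢
  obtain ⟨a, ha, hxa⟩ := hx
  exact ⟨a, ha, hyx.trans hxa⟩

/-- The complement image of the up-closure, `(D ⊻ univ)ᶜˢ`, is a lower family. [this work] -/
theorem isLowerSet_compls_sups_univ (D : Finset (Finset β)) : IsLowerSet (((D ⊻ univ)ᶜˢ : Finset (Finset β)) : Set (Finset β)) := by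
  intro x y hyx hx
  rw [Finset.mem_coe, Finset.mem_compls, mem_sups_univ] at hx ⊢
  obtain ⟨a, ha, hax⟩ := hx
  exact ⟨a, ha, hax.trans (compl_le_compl hyx)⟩

/-- **SHADOW LEMMA.**  For every family `D` of subsets of a finite type: `#D ≤ #((D ⊼ univ) ∩ (D ⊻ univ)ᶜˢ)`, i.e. the number of sets
`ξ` with `ξ ⊆ η \ η′` for some `η, η′ ∈ D` is at least `#D`.  Daykin's inequality with `univ` plus Harris–Kleitman for the two lower families
`D ⊼ univ` and `(D ⊻ univ)ᶜˢ`. [this work] -/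
theorem card_le_card_infs_inter_compls_sups (D : Finset (Finset β)) :
    #D ≤ #((D ⊼ univ) ∩ (D ⊻ univ)ᶜˢ) := by
  have hD := Finset.le_card_infs_mul_card_sups D (univ : Finset (Finset β))
  rw [Finset.card_univ, Fintype.card_finset] at hD
  -- hD : #D * 2 ^ card β ≤ #(D ⊼ univ) * #(D ⊻ univ)
  have hK := (isLowerSet_infs_univ D).le_card_inter_finset (isLowerSet_compls_sups_univ D)
  rw [Finset.card_compls] at hK
  -- hK : #(D ⊼ univ) * #(D ⊻ univ) ≤ 2 ^ card β * #(D ⊼ univ ∩ (D ⊻ univ)ᶜˢ)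
  have h : #D * 2 ^ Fintype.card β ≤ 2 ^ Fintype.card β * #((D ⊼ univ) ∩ (D ⊻ univ)ᶜˢ) := hD.trans hK
  rw [mul_comm] at h
  exact Nat.le_of_mul_le_mul_left h (by positivity)

end AntitheticShadow

end Summit.CriticalPhenomena.PercolationContinuityZ3.Theorems
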